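import Summits.ResolutionOfSingularities.ResolutionOfSingularities.Theorems.PlanarCurveTrap
import HarnessLib

/-!
# PlanarCurveTrap2 — decomp-res node «CurveTrap» (lens-5 g26, critic row 177 CLEARED DECIDED +1), tree file 7/7 of the node

Content VERBATIM from the decomp-res lens-5 g26 node `HOME/decomp-res-lens-5/g26/CurveTrap.lean` (pin 39d382f9;
imports the landed tree only, carries nothing);
HOME = run/shared/lean/pub/decomp-res; critic row 177 CLEARED DECIDED +1; landing orders NODE §8 / INBOX :842 —
provenance, critic text and the lens header in full in the first
file of the node, `PlanarCurveTrapQPow`.  Namespace `…Theorems.CurveTrap`; `--supports stmt-ResolutionOfSingularities-31770`.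

## This file

Continuation 2/2 of `PlanarCurveTrap` (same sections of the node, cut at the 400-line cap): carries
`noLowEmptyIsolatedSectionTailsDeep_holds`, `defectWalksDeep_iff_curveTrap`, `terminal_iff_lowLive`,
`closes_curveTrap`, `closes_curveTrap_leaves`.

[WRITER NOTE (decomp-res writer g11): file split only (tree files ≤ 400 lines); namespace, sections, section
variables, the `open` block and every
declaration exactly as in the lens (the node's global dupNamespace-linter line is dropped — the library sets it);
ONE deletion (gate dedup
rule, critic :842 watch-list): the node's copy `eq_single_add_single_two` is NOT re-landed — it is LITERALLY the landed
`HauserPerlega2024.finsupp_eq_single_add_single` (`PointBlowupFlagTranslatedStep`, imported; namespace opened as in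
the lens), cited by name at its two uses; no instance, no notation, no include/omit added.]

(Sources: HauserPerlega2024 (characteristic-free resolution of surfaces by point blowups: Props. 3–4, the monomial
case); Hauser2010 Lectures VII–IX; CossartJannsenSaito2020 Ch. 5; Moh1987; BenitoVillamayor2014; the Hasse–Schmidt /
point-blowup flag formalism of the tree (Literature PointBlowupFlag*).)
-/

open MvPolynomial Finset
open Literature.AlgebraicGeometry.Resolution
open Literature.AlgebraicGeometry.Resolution.Hauser2010
open Literature.AlgebraicGeometry.Resolution.HauserPerlega2024
open Literature.AlgebraicGeometry.Resolution.PointBlowup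
open Literature.AlgebraicGeometry.Resolution.WeightedBlowup
open Summit.ResolutionOfSingularities.ResolutionOfSingularities.Theses
open Summit.ResolutionOfSingularities.ResolutionOfSingularities.Theorems.TightDefectClasses
open Summit.ResolutionOfSingularities.ResolutionOfSingularities.Theorems.TightDefectStrongWalks
open Summit.ResolutionOfSingularities.ResolutionOfSingularities.Theorems.ItineraryCutClasses
open Summit.ResolutionOfSingularities.ResolutionOfSingularities.Theorems.ProximityCut
open Summit.ResolutionOfSingularities.ResolutionOfSingularities.Theorems.ExitLaw
open Summit.ResolutionOfSingularities.ResolutionOfSingularities.Theorems.PlanarCut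
open Summit.ResolutionOfSingularities.ResolutionOfSingularities.Theorems.CoefficientCut
open Summit.ResolutionOfSingularities.ResolutionOfSingularities.Theorems.PlanarPort
open Summit.ResolutionOfSingularities.ResolutionOfSingularities.Theorems.SectionLift

namespace Summit.ResolutionOfSingularities.ResolutionOfSingularities.Theorems.CurveTrap

section Walk

variable {K : Type} [Field K] [DecidableEq K] {i j k : Fin 3}

/-- **THE LOW-EMPTY TERMINAL CLASS IS EMPTY (PROVED, hypothesis-free):** `NoLowEmptyIsolatedSectionTailsDeep` — the
g25 located residual class (T-1′) of critic row 172 — holds outright.  START (§I) at the terminal time `t₀ ≥ N` puts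
the section state in CURVE FORM `X_m^b W^a U + S_q`, `1 ≤ a < q`; the ORDER LAW gives `a + b ≥ q + 1`; each planar
move (read on the section by `secState_step_F`, on series by the §F bridge) either keeps CURVE FORM with the MOVE
CLOCK `b ↦ a + b − q < b` (STEP LAWS §G, letters possibly swapped) or produces an END FORM, which the END LAW turns
into a fat point (binder (I)) or an `h = 0` monomial flag (binder (G)); strong induction on `b`. [new] (Sources:
HauserPerlega2024, §3 p. 775, §5 p. 783, Prop. 3 proof p. 792.) -/
theorem noLowEmptyIsolatedSectionTailsDeep_holds : NoLowEmptyIsolatedSectionTailsDeep := by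
  intro p hp e he K _ _ _ _ s₀ hs W hsh N hpl hex hS hb i j k hij hjk hik hP h0 hled hL hio hΛ hI hG0
  classical
  haveI : Fact p.Prime := ⟨hp⟩
  -- degrees along the tail
  have hdeg3 : ∀ t, ∀ d ∈ (W.st t).F.support, p ^ e ≤ d.degree := fun t d hd => le_degree_of_mem_support hs W t hd
  have hlt : ∀ t, N ≤ t → ((p ^ e : ℕ) : ℕ∞) < ordZero (W.st t).F := fun t ht =>
    lt_of_le_of_ne (walk_ord hs W t) (hex t ht).symm
  have hdegq1 : ∀ t, N ≤ t → ∀ d ∈ (W.st t).F.support, p ^ e + 1 ≤ d.degree := by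
    intro t ht d hd
    by_contra hlt'
    push Not at hlt'
    refine mem_support_iff.mp hd (coeff_eq_zero_of_degree_lt_ordZero (lt_of_le_of_lt ?_ (hlt t ht)))
    exact_mod_cast (by omega : d.degree ≤ p ^ e)
  have hdegS : ∀ t, N ≤ t → ∀ c ∈ (secState i j k (W.st t)).F.support, p ^ e + 1 ≤ c.degree :=
    fun t ht c hc => le_degree_of_mem_support_secState hij hjk hik (hdegq1 t ht) hc
  have hl : ∀ t, N ≤ t → W.j t = i ∨ W.j t = j := by
    intro t ht
    rcases fin3_cases ⟨hij, hjk, hik⟩ (W.j t) with h | h | h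
    · exact Or.inl h
    · exact Or.inr h
    · exact absurd h (hP t ht).1
  -- the section's move, read on power series
  have hcoe : ∀ t, N ≤ t → ((secState i j k (W.st (t + 1))).F : MvPowerSeries (Fin 2) (Kbar K)) =
      cleanSeries (p ^ e) ((pointTransform (p ^ e) (idx i (W.j t)) (ι K ∘ secPt i j (W.b t))
        (secState i j k (W.st t)) : MvPolynomial (Fin 2) (Kbar K)) : MvPowerSeries (Fin 2) (Kbar K)) := by
    intro t ht
    rw [W.st_succ, secState_step_F hij hjk hik (p ^ e) (hl t ht) (W.b t) (W.onExc t) (hP t ht).2 (W.st t) (hdeg3 t),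
      step_F, coe_deletePthPowers]
  have hptx : ∀ t, N ≤ t → (ι K ∘ secPt i j (W.b t)) (idx i (W.j t)) = 0 := fun t ht => by
    rw [Function.comp_apply, secPt_idx_eq_zero hij (hl t ht) (W.b t) (W.onExc t), map_zero]
  have hE : ∀ t, N ≤ t → excLetters (secState i j k (W.st (t + 1))) ≠ ∅ := fun t ht =>
    excLetters_secState_succ_ne_empty hij hjk hik W t (hl t ht) (hlt t ht) (h0 t ht)
  have hclean : ∀ t, deletePthPowers (p ^ e) (secState i j k (W.st t)).F = (secState i j k (W.st t)).F := fun t =>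
    secState_clean hij hjk hik (p ^ e) (walk_clean hs W t)
  have hnotM : ∀ t, N ≤ t → ¬ IsMonomialCase (p ^ e) (excLetters (secState i j k (W.st t)))
      ((secState i j k (W.st t)).F : MvPowerSeries (Fin 2) (Kbar K)) := by
    intro t ht hM
    have h1 := hG0 t ht ⟨0, 1, 0⟩ rfl
    rw [expansion_of_h_zero (⟨0, 1, 0⟩ : FlagDatum (Fin 2) (Kbar K)) rfl, hclean t] at h1
    exact h1 (Or.inl hM)
  -- DESCENT on the move clock `b`
  have descent : ∀ (b t : ℕ) (m n : Fin 2) (a : ℕ), N ≤ t → m ≠ n → (∀ l, l = m ∨ l = n) → 1 ≤ a → a < p ^ e →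
      InCurveForm (p ^ e) ((secState i j k (W.st t)).F : MvPowerSeries (Fin 2) (Kbar K)) m n a b → False := by
    intro b
    induction b using Nat.strong_induction_on with
    | _ b ih =>
      intro t m n a ht hmn hσ ha1 haq hcf
      -- ORDER LAW: `X_m^b X_n^a ∈ supp`, so `a + b ≥ q + 1`
      have hab : p ^ e + 1 ≤ a + b := by
        have hc := coeff_ne_zero_of_inCurveForm hmn hσ ha1 haq hcf
        rw [MvPolynomial.coeff_coe] at hc
        have h1 := hdegS t ht _ (mem_support_iff.mpr hc)
        rw [map_add, Finsupp.degree_single, Finsupp.degree_single] at h1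
        omega
      have hcoe_t := hcoe t ht
      have hptx_t := hptx t ht
      obtain ⟨x, hx⟩ : ∃ x : Fin 2, idx i (W.j t) = x := ⟨_, rfl⟩
      rw [hx] at hcoe_t hptx_t
      set pt : Fin 2 → Kbar K := ι K ∘ secPt i j (W.b t) with hpt
      have hFq : ∀ d ∈ (secState i j k (W.st t)).F.support, p ^ e ≤ d.degree := fun d hd =>
        (Nat.le_succ _).trans (hdegS t ht d hd)
      have ht1 : N ≤ t + 1 := by omega
      rcases hσ x with hxm | hxn
      · -- chart = the monomial letter `m`
        rw [hxm] at hcoe_t hptx_t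
        have hPT := X_pow_mul_coe_pointTransform hmn hσ (p ^ e) pt hptx_t (secState i j k (W.st t)) hFq
        rcases step_chart_monomial p e hmn hσ (by omega) hcf (pt n) hPT with hc' | hend
        · exact ih (a + b - p ^ e) (by omega) (t + 1) m n a ht1 hmn hσ ha1 haq
            (by rw [hcoe_t]; exact hc'.of_cleanSeries)
        · exact false_of_inEndForm p e hcoe_t hend (x := m) (y := n) (Ne.symm hmn)
            (by rw [Finsupp.single_eq_same]; omega) (hI (t + 1) ht1) (hE t ht) (hnotM (t + 1) ht1)
      · -- chart = the curve letter `n` (letters swap)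
        rw [hxn] at hcoe_t hptx_t
        have hσ' : ∀ l, l = n ∨ l = m := fun l => (hσ l).symm
        have hPT := X_pow_mul_coe_pointTransform (Ne.symm hmn) hσ' (p ^ e) pt hptx_t (secState i j k (W.st t)) hFq
        rcases step_chart_curve p e hmn hσ (by omega) hcf (pt m) hPT with hc' | ⟨β, hβn, hend⟩
        · exact ih (a + b - p ^ e) (by omega) (t + 1) n m a ht1 (Ne.symm hmn) hσ' ha1 haq
            (by rw [hcoe_t]; exact hc'.of_cleanSeries)
        · exact false_of_inEndForm p e hcoe_t hend (x := n) (y := m) hmn (by omega) (hI (t + 1) ht1) (hE t ht)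
            (hnotM (t + 1) ht1)
  -- START at the terminal time `t₀ ≥ N`
  obtain ⟨t₀, ht₀, Φ, hN0, hT⟩ := hio N
  have hWF : Φ.WF := hN0.1
  obtain ⟨a, b, ha1, haq, hcf⟩ :=
    start p e Φ hWF (fin2_cover (Ne.symm hWF.1)) hT (hI t₀ ht₀) (hdegS t₀ ht₀)
  exact descent b t₀ Φ.other Φ.curve a ht₀ (Ne.symm hWF.1) (fin2_cover (Ne.symm hWF.1)) ha1 haq hcf

/-- **THE NODE EQUATION g26 (PROVED, hypothesis-free, EXACT):** `MaxContactCut.DefectWalksDeep` (31770) `⟺` deep arc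
law `∧` (H-P half `∧` the LOW-LIVE terminal class) `∧` positive skew leaf `∧` null-flat skew leaf — the g25 LOW-EMPTY
class is DROPPED (proved). [new] [folklore] -/
theorem defectWalksDeep_iff_curveTrap : MaxContactCut.DefectWalksDeep ↔
    NoFreePointTailsDeep ∧ (NoNonTerminalSectionPlanarJointTailsDeep ∧ NoLowLiveTerminalSectionPlanarTailsDeep) ∧
      StallVertex.NoPositiveSkewStalledTailsDeep ∧ StallVertex.NoNullFlatSkewStalledTailsDeep := by
  rw [defectWalksDeep_iff_sectionLift, and_iff_right noLowEmptyIsolatedSectionTailsDeep_holds]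

/-- The g24 terminal leaf is now EXACTLY the low-live class. [folklore] -/
theorem terminal_iff_lowLive : NoTerminalSectionPlanarJointTailsDeep ↔ NoLowLiveTerminalSectionPlanarTailsDeep := by
  rw [terminal_iff_lowEmpty_lowLive, lowEmptyTerminal_iff_isolatedSection,
    and_iff_right noLowEmptyIsolatedSectionTailsDeep_holds]

/-- **`closes` (PROVED modulo [HP24] Prop. 3 + Prop. 4 as named propositions):** deep arc law `∧` the LOW-LIVE
terminal class `∧` skew residual `⟹ MaxContactCut.DefectWalksDeep` — 31770 BY NAME, through `closes_sectionLift`.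
[folklore] -/
theorem closes_curveTrap (hA : NoFreePointTailsDeep) (hP3 : HP24Prop3) (hP4 : HP24Prop4)
    (hL : NoLowLiveTerminalSectionPlanarTailsDeep) (hR : NoSkewJointTailsDeep) : MaxContactCut.DefectWalksDeep :=
  closes_sectionLift hA hP3 hP4 noLowEmptyIsolatedSectionTailsDeep_holds hL hR

/-- `closes` on the current leaves of the skew side. [folklore] -/
theorem closes_curveTrap_leaves (hA : NoFreePointTailsDeep) (hP3 : HP24Prop3) (hP4 : HP24Prop4)
    (hL : NoLowLiveTerminalSectionPlanarTailsDeep) (hI : StallVertex.NoPositiveSkewStalledTailsDeep)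
    (hZ : StallVertex.NoNullFlatSkewStalledTailsDeep) : MaxContactCut.DefectWalksDeep :=
  closes_sectionLift_leaves hA hP3 hP4 noLowEmptyIsolatedSectionTailsDeep_holds hL hI hZ

end Walk

end Summit.ResolutionOfSingularities.ResolutionOfSingularities.Theorems.CurveTrap
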